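import Literature.AlgebraicGeometry.Motives.FaltingsECEndCoreOpenSubgroupProofs
import Literature.AlgebraicGeometry.Motives.FaltingsECEndCoreCasesProofs
import Literature.NumberTheory.EllipticCurves.IsogenyGeomEndRingGaloisProofs
import Literature.NumberTheory.EllipticCurves.TateModuleProjSurjectiveProofs
import HarnessLib

/-!
# Faltings 1983, Satz 4 for an elliptic curve with potential complex multiplication

Theorem-only `Proofs` companion of `Literature.AlgebraicGeometry.Motives.FaltingsECEndCore`, which
vendors the named fact
`Literature.AlgebraicGeometry.Motives.exists_eq_smul_one_of_equivariant_of_not_hasRationalCM W ℓ`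
— the residual core of G. Faltings, *Endlichkeitssätze für abelsche Varietäten über
Zahlkörpern*, Invent. Math. **73** (1983), §5 Satz 4 for `A = E` an elliptic curve over a number
field `K` (Engl. transl. Cornell–Silverman, *Arithmetic Geometry* (1986), Ch. II §5 Theorem 4;
held copy `book:cornellnd-arithmetic-geometry`, PDF pp. 89–90): for `End_K(E) = ℤ` and `V_ℓ E`
without `Γ_K`-stable line, `End_{Γ_K}(V_ℓ E) = ℚ_ℓ`; equivalently
(`FaltingsECEndCoreProofs`) the image of `Γ_K` in `GL(V_ℓ E)` is not abelian.

This file **proves the core fact for every elliptic curve with complex multiplication over `K̄`**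
(`W.HasCM`: `End_{K̄}(E) ≠ ℤ`), whether or not the complex multiplication is defined over `K` —
the case J.-P. Serre, *Abelian ℓ-adic representations and elliptic curves* (1968), Ch. IV §2.2
treats in the Remark after the Theorem ("if `E` has complex multiplication over `K̄` but not over
`K`, … the group `ρ_ℓ(G)` is not abelian"). Together with `FaltingsECEndCoreCasesProofs` (real
place; multiplicative place `v ∤ ℓ`; `ord_v(j) < 0` at some `v ∤ ℓ`) this leaves the named fact
open exactly for curves **without** complex multiplication over `K̄`, over a totally imaginary
`K`, with `j(E)` integral at all `v ∤ ℓ` (`exists_eq_smul_one_of_equivariant_of_not_hasRationalCM_iff_of_not_hasCM`):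
Serre's open-image theorem territory (1968 IV.2.2 via Hodge–Tate decompositions; Faltings 1983
via Sätze 1–2 for the abelian surfaces `(E × E)/G_n`).

## The proof (`exists_mul_ne_mul_of_hasCM`)

Let `E` have no `K`-rational complex multiplication but `φ ∈ End_{K̄}(E) ∖ ℤ`, and suppose all
`ρ_ℓ(σ)`, `σ ∈ Γ_K`, commute on `V_ℓ E`.
1. `φ` commutes with an open subgroup `U ≤ Γ_K` (it is defined over a finite extension:
   `WeierstrassCurve.exists_isOpen_forall_smul_comm_of_mem_geomEndRing`,
   `IsogenyGeomEndRingGaloisProofs`, Silverman *AEC* I.§3), so `T = V_ℓ(φ)` commutes with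
   `ρ_ℓ(U)`.
2. Some `σ₁ ∈ U` acts by a non-scalar (`exists_mem_not_exists_eq_smul_one_of_isOpen`,
   `FaltingsECEndCoreOpenSubgroupProofs`: no open subgroup of `Γ_K` acts on `V_ℓ E` by scalars —
   Shafarevich, line realization and Satz 4 for `K`-rational CM over the number field `K̄^U`).
3. In the plane `V_ℓ E` the commutant of the non-scalar `ρ_ℓ(σ₁)` is `ℚ_ℓ + ℚ_ℓ ρ_ℓ(σ₁)`
   (`exists_eq_smul_one_add_smul_of_commute`), which commutes with every `ρ_ℓ(σ)`; so `T` is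
   `Γ_K`-equivariant.
4. Hence `T_ℓ(σ φ σ⁻¹ - φ) = 0` for every `σ ∈ Γ_K`, with `σ φ σ⁻¹ - φ ∈ End_{K̄}(E)`
   (`WeierstrassCurve.conj_mem_geomEndRing`); but `T_ℓ` is faithful on `End_{K̄}(E)`
   (`eq_zero_of_mem_geomEndRing_of_tateModule_map_eq_zero`: a non-zero geometric endomorphism is
   algebraic with finite kernel, *AEC* III.4.9, while it would kill the infinite `ℓ`-primary
   torsion, `WeierstrassCurve.proj_surjective_of_isAlgClosed_holds` and `rank T_ℓ E = 2`), so
   `σ φ σ⁻¹ = φ`: `φ ∈ End_K(E) ∖ ℤ`, i.e. `E` has `K`-rational complex multiplication —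
   contradiction.

## Contents (all proved; no definitions, no new named facts)

* `tateModule_map_toAddMonoidEnd`, `tateModule_map_mul`, `tateModule_map_sub`,
  `toRational_apply_eq_baseChangeHom`, `eq_zero_of_baseChangeHom_eq_zero`: `T_ℓ` of the Galois
  action, of composites and differences of
  additive endomorphisms of `E(K̄)`, and `T_ℓ E ↪ V_ℓ E` intertwines `T_ℓ(f)` and `1 ⊗ T_ℓ(f)`.
* `eq_zero_of_mem_geomEndRing_of_tateModule_map_eq_zero`: `T_ℓ` is faithful on `End_{K̄}(E)`
  (`ℓ ≠ char K`).
* `exists_mul_ne_mul_of_hasCM`: for `E` over a number field with CM over `K̄` but not over `K`,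
  the image of `Γ_K` in `GL(V_ℓ E)` is not abelian.
* `exists_eq_smul_one_of_equivariant_of_not_hasRationalCM_of_hasCM`: **the core fact for every
  curve with complex multiplication over `K̄`**;
  `exists_eq_smul_one_of_equivariant_of_not_hasRationalCM_iff_of_not_hasCM`: the named fact is
  equivalent to its restriction to curves without complex multiplication over `K̄`.
* `mem_span_range_tateEndRingHom_iff_of_hasCM` (**Faltings' Satz 4 for `E`**),
  `stable_subspace_prod_eq_range_of_hasCM` (the subspace statement for `E × E`),
  `mem_span_range_tateModule_map_of_equivariant_self_of_hasCM` (**Korollar 1 for `(E, E)`**) —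
  unconditionally for every elliptic curve with complex multiplication over `K̄`, over every
  number field `K` and for every prime `ℓ`.
* `exists_eq_smul_one_of_equivariant_of_not_hasRationalCM_of_residual`: over a number field the
  named fact follows from its restriction to curves without CM over `K̄`, over a totally imaginary
  `K`, with `ord_v(j) ≥ 0` at every `v ∤ ℓ` (the three proved families of cases removed).

## References

* [Faltings1983Endlichkeit] G. Faltings, Invent. Math. 73 (1983), 349–366, §5 Satz 4 and
  Korollar 1; Engl. transl. in Cornell–Silverman (eds.), *Arithmetic Geometry* (1986), Ch. II §5
  (held copy `book:cornellnd-arithmetic-geometry`, PDF pp. 89–90; read).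
* [Serre1968] J.-P. Serre, *Abelian ℓ-adic representations and elliptic curves*, Benjamin 1968,
  Ch. IV §2.1–2.2 (Theorem and the Remark on complex multiplication over `K̄` but not over `K`).
* [SilvermanAEC2009] J. H. Silverman, *The Arithmetic of Elliptic Curves*, 2nd ed., I.§3,
  III.4.9, III.§7, III.§9, Cor. IX.6.2.

## Design

Theorems only; `noncomputable section`; one universe `u`; base field `K : Type u` with
`[NumberField K] [W.IsElliptic]` instance hypotheses (inside the named facts they are binders);
the Galois action on `E(K̄)` as additive endomorphisms is Mathlib's
`DistribMulAction.toAddMonoidEnd Γ_K E(K̄)`, and `V_ℓ(f) = 1 ⊗ T_ℓ(f)` is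
`Module.End.baseChangeHom ℤ_ℓ ℚ_ℓ (T_ℓ E)` applied to `TateModule.map ℓ f`, as in
`FaltingsECEndCore`.
-/

noncomputable section

open scoped TensorProduct

universe u

namespace Literature.AlgebraicGeometry.Motives

open WeierstrassCurve Module Literature.NumberTheory.EllipticCurves Field

/-! ## `T_ℓ` of additive endomorphisms of a discrete module -/

section TateFunctor

variable {A : Type u} [AddCommGroup A] (p : ℕ) [Fact p.Prime]

/-- `T_p` of a composite of additive endomorphisms is the composite (the tree's
`TateModule.map_comp`, in `Module.End`). Silverman, *AEC*, III.§7 (`T_ℓ` is a functor). [folklore] -/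
theorem tateModule_map_mul (f g : AddMonoid.End A) :
    TateModule.map p ((f * g : AddMonoid.End A) : A →+ A) =
      TateModule.map p (f : A →+ A) * TateModule.map p (g : A →+ A) :=
  TateModule.map_comp _ _

/-- `T_p` of a difference of additive endomorphisms is the difference. Silverman, *AEC*, III.§7.
[folklore] -/
theorem tateModule_map_sub (f g : AddMonoid.End A) :
    TateModule.map p ((f - g : AddMonoid.End A) : A →+ A) =
      TateModule.map p (f : A →+ A) - TateModule.map p (g : A →+ A) :=
  LinearMap.ext fun a ↦ TateModule.ext fun n ↦ by
    rw [LinearMap.sub_apply, map_sub, TateModule.proj_map, TateModule.proj_map,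
      TateModule.proj_map]
    rfl

variable {G : Type*} [Group G] [DistribMulAction G A]

/-- `T_p` of the action of `g ∈ G` on the discrete module `A` is the action of `g` on `T_p A`
(`tateRepresentation`). Silverman, *AEC*, III.§7. [folklore] -/
theorem tateModule_map_toAddMonoidEnd (g : G) :
    TateModule.map p ((DistribMulAction.toAddMonoidEnd G A g : AddMonoid.End A) : A →+ A) =
      tateRepresentation G A p g :=
  LinearMap.ext fun a ↦ TateModule.ext fun n ↦ by
    rw [TateModule.proj_map, tateRepresentation_apply_apply,
      TateModule.proj_smul_of_distribMulAction]
    rfl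

/-- `T_p A ↪ V_p A` intertwines `T_p(f)` and `1 ⊗ T_p(f)`. [folklore] -/
theorem toRational_apply_eq_baseChangeHom (f : Module.End ℤ_[p] (TateModule A p))
    (x : TateModule A p) :
    TateModule.toRational p (f x) =
      (Module.End.baseChangeHom ℤ_[p] ℚ_[p] (TateModule A p) f :
        Module.End ℚ_[p] (RationalTateModule A p)) (TateModule.toRational p x) :=
  (LinearMap.baseChange_tmul (A := ℚ_[p]) (f := f) 1 x).symm

/-- `f ↦ 1 ⊗ f`, `End(T_p A) → End(V_p A)`, is injective (`T_p A ↪ V_p A`,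
`TateModule.toRational_injective`). [folklore] -/
theorem eq_zero_of_baseChangeHom_eq_zero {f : Module.End ℤ_[p] (TateModule A p)}
    (hf : (Module.End.baseChangeHom ℤ_[p] ℚ_[p] (TateModule A p) f :
      Module.End ℚ_[p] (RationalTateModule A p)) = 0) : f = 0 := by
  refine LinearMap.ext fun x ↦ TateModule.toRational_injective (p := p) ?_
  rw [toRational_apply_eq_baseChangeHom, hf, LinearMap.zero_apply, LinearMap.zero_apply, map_zero]
  rfl

end TateFunctor

variable {K : Type u} [Field K] (W : WeierstrassCurve K) (ℓ : ℕ) [Fact ℓ.Prime]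

/-! ## `T_ℓ` is faithful on `End_{K̄}(E)` -/

/-- **A geometric endomorphism killed by `T_ℓ` is zero** (`ℓ ≠ char K`). A non-zero
`ψ ∈ End_{K̄}(E)` is algebraic (`WeierstrassCurve.mem_geomEndRing_iff_holds`), hence has finite
kernel (*AEC* III.4.9, `IsAlgebraicOn.finite_ker`); but if `T_ℓ(ψ) = 0` then `ψ` kills every
`ℓ`-primary torsion point (each is a component of an element of `T_ℓ E`,
`WeierstrassCurve.proj_surjective_of_isAlgClosed_holds`), and these are infinitely many
(`rank T_ℓ E = 2`, `TateModule.finrank_eq_zero_of_finite`). Silverman, *AEC*, III.7.4 (injectivity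
of `Hom(E₁, E₂) ⊗ ℤ_ℓ → Hom(T_ℓ E₁, T_ℓ E₂)`, degree argument). [cite: SilvermanAEC2009, Thm. III.7.4] -/
theorem eq_zero_of_mem_geomEndRing_of_tateModule_map_eq_zero [W.IsElliptic] (hℓK : (ℓ : K) ≠ 0)
    {ψ : AddMonoid.End W.geomPoints} (hψ : ψ ∈ W.geomEndRing)
    (h0 : TateModule.map ℓ (ψ : W.geomPoints →+ W.geomPoints) = 0) : ψ = 0 := by
  rcases (mem_geomEndRing_iff_holds W ψ).mp hψ with rfl | halg
  · rfl
  · exfalso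
    -- every `ℓ`-primary torsion point lies in the kernel
    have hker : {P : W.geomPoints | ∃ n : ℕ, ℓ ^ n • P = 0} ⊆
        ((ψ : W.geomPoints →+ W.geomPoints).ker : Set W.geomPoints) := by
      rintro P ⟨n, hn⟩
      have hP : P ∈ geomTorsion W ((ℓ ^ n : ℕ) : ℤ) := AddSubgroup.torsionBy.nsmul_iff.mpr hn
      obtain ⟨a, ha⟩ := proj_surjective_of_isAlgClosed_holds W ℓ n hP
      rw [SetLike.mem_coe, AddMonoidHom.mem_ker, ← ha, ← TateModule.proj_map, h0,
        LinearMap.zero_apply, map_zero]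
    -- and there are infinitely many of them
    have hinf : {P : W.geomPoints | ∃ n : ℕ, ℓ ^ n • P = 0}.Infinite := by
      intro hfin
      have h0' := TateModule.finrank_eq_zero_of_finite (p := ℓ) hfin
      have h2 := finrank_tateModule_eq_two_holds W ℓ hℓK
      change Module.finrank ℤ_[ℓ] (W.tateModule ℓ) = 0 at h0'
      omega
    exact hinf (halg.finite_ker.subset hker)

/-! ## The image of `Γ_K` is not abelian for a curve with CM over `K̄` but not over `K` -/

/-- **Potential but not rational complex multiplication forces a non-abelian `ℓ`-adic image.**
Let `E = W` be an elliptic curve over a number field `K` with complex multiplication over `K̄`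
(`W.HasCM`) but `End_K(E) = ℤ` (`¬ W.HasRationalCM`), and `ℓ` a prime. Then some
`ρ_ℓ(σ), ρ_ℓ(τ)` do not commute on `V_ℓ E`. See the module docstring for the proof
(Serre 1968, IV.2.2, Remark). [cite: Serre1968, Ch. IV §2.2 (Remark: complex multiplication over K̄ but not over K)] -/
theorem exists_mul_ne_mul_of_hasCM [NumberField K] [W.IsElliptic] (hCM : W.HasCM)
    (hnCM : ¬ W.HasRationalCM) :
    ∃ σ τ : absoluteGaloisGroup K,
      rationalGaloisRepTate W ℓ σ * rationalGaloisRepTate W ℓ τ ≠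
        rationalGaloisRepTate W ℓ τ * rationalGaloisRepTate W ℓ σ := by
  have hℓK : ((ℓ : ℕ) : K) ≠ 0 := Nat.cast_ne_zero.mpr (Fact.out : ℓ.Prime).ne_zero
  have h2 := finrank_rationalTateModule_eq_two_holds W ℓ hℓK
  by_contra hab
  push Not at hab
  obtain ⟨φ, hφ, hφn⟩ := hCM
  -- notation: the Galois action as additive endomorphisms, `T_ℓ`, `V_ℓ = 1 ⊗ T_ℓ`
  set s : absoluteGaloisGroup K →* AddMonoid.End W.geomPoints :=
    DistribMulAction.toAddMonoidEnd (absoluteGaloisGroup K) W.geomPoints with hs_def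
  -- `f ↦ 1 ⊗ f : End(T_ℓ E) → End(V_ℓ E)`, read on the synonym `V_ℓ E = W.rationalTateModule ℓ`
  let B : Module.End ℤ_[ℓ] (W.tateModule ℓ) →ₐ[ℤ_[ℓ]] Module.End ℚ_[ℓ] (W.rationalTateModule ℓ) :=
    Module.End.baseChangeHom ℤ_[ℓ] ℚ_[ℓ] (W.tateModule ℓ)
  have hsT : ∀ σ : absoluteGaloisGroup K,
      TateModule.map ℓ ((s σ : AddMonoid.End W.geomPoints) : W.geomPoints →+ W.geomPoints) =
        galoisRepTate W ℓ σ :=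
    fun σ ↦ tateModule_map_toAddMonoidEnd ℓ σ
  have hBρ : ∀ σ : absoluteGaloisGroup K, B (galoisRepTate W ℓ σ) = rationalGaloisRepTate W ℓ σ :=
    fun σ ↦ rfl
  set Tφ : Module.End ℤ_[ℓ] (W.tateModule ℓ) :=
    TateModule.map ℓ (φ : W.geomPoints →+ W.geomPoints) with hTφ_def
  set T : Module.End ℚ_[ℓ] (W.rationalTateModule ℓ) := B Tφ with hT_def
  -- Step 1: `φ` commutes with an open subgroup `U`
  obtain ⟨U, hU, hUφ⟩ := W.exists_isOpen_forall_smul_comm_of_mem_geomEndRing hφ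
  -- Step 2: some `σ₁ ∈ U` is not a scalar on `V_ℓ E`
  obtain ⟨σ₁, hσ₁U, hσ₁⟩ := exists_mem_not_exists_eq_smul_one_of_isOpen W ℓ U hU
  -- Step 3: `T` commutes with `ρ(σ₁)`, hence with every `ρ(σ)`
  have hφσ₁ : φ * s σ₁ = s σ₁ * φ := AddMonoidHom.ext fun P ↦ hUφ σ₁ hσ₁U P
  have hT₁ : T * rationalGaloisRepTate W ℓ σ₁ = rationalGaloisRepTate W ℓ σ₁ * T := by
    rw [← hBρ, hT_def, ← map_mul, ← map_mul, hTφ_def, ← hsT, ← tateModule_map_mul,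
      ← tateModule_map_mul, hφσ₁]
  obtain ⟨p, q, hpq⟩ := exists_eq_smul_one_add_smul_of_commute h2 hσ₁ hT₁
  have hTσ : ∀ σ : absoluteGaloisGroup K,
      T * rationalGaloisRepTate W ℓ σ = rationalGaloisRepTate W ℓ σ * T := fun σ ↦ by
    rw [hpq, add_mul, mul_add, smul_mul_assoc, mul_smul_comm, one_mul, mul_one, smul_mul_assoc,
      mul_smul_comm, hab σ₁ σ]
  -- Step 4: `φ` is `Γ_K`-equivariant, by faithfulness of `T_ℓ` on `End_{K̄}(E)`
  have hφeq : ∀ (σ : absoluteGaloisGroup K) (P : W.geomPoints), φ (σ • P) = σ • φ P := by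
    intro σ
    have hψmem : s σ * φ * s σ⁻¹ - φ ∈ W.geomEndRing :=
      W.geomEndRing.sub_mem (W.conj_mem_geomEndRing hφ σ) hφ
    have hψT : TateModule.map ℓ
        ((s σ * φ * s σ⁻¹ - φ : AddMonoid.End W.geomPoints) : W.geomPoints →+ W.geomPoints) = 0 := by
      apply eq_zero_of_baseChangeHom_eq_zero ℓ
      change B (TateModule.map ℓ ((s σ * φ * s σ⁻¹ : AddMonoid.End W.geomPoints) -
        (φ : AddMonoid.End W.geomPoints))) = 0
      rw [tateModule_map_sub, tateModule_map_mul, tateModule_map_mul, hsT, hsT, map_sub, map_mul,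
        map_mul, hBρ, hBρ, ← hTφ_def, ← hT_def, mul_assoc, hTσ σ⁻¹, ← mul_assoc, ← map_mul,
        mul_inv_cancel, map_one, one_mul, sub_self]
    have hψ0 := eq_zero_of_mem_geomEndRing_of_tateModule_map_eq_zero W ℓ hℓK hψmem hψT
    intro P
    have h := congrArg (fun χ : AddMonoid.End W.geomPoints ↦ χ (σ • P)) (sub_eq_zero.mp hψ0)
    simp only [hs_def, toAddMonoidEnd_mul_mul_toAddMonoidEnd_inv_apply, inv_smul_smul] at h
    exact h.symm
  -- so `φ ∈ End_K(E) ∖ ℤ`: `E` has `K`-rational complex multiplication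
  exact hnCM ⟨φ, ⟨hφ, fun σ P ↦ hφeq σ P⟩, hφn⟩

/-! ## The core fact, Satz 4, the subspace statement and Korollar 1 for curves with CM over `K̄` -/

/-- **The core fact for a curve with complex multiplication over `K̄`.** For a Weierstrass curve
`W` over a field `K` with `W.HasCM` (`End_{K̄}(E) ≠ ℤ`) and a prime `ℓ`,
`exists_eq_smul_one_of_equivariant_of_not_hasRationalCM W ℓ` holds: for `K` a number field and
`E` elliptic with `End_K(E) = ℤ` the image of `Γ_K` in `GL(V_ℓ E)` is not abelian
(`exists_mul_ne_mul_of_hasCM`), and a non-scalar equivariant endomorphism of the plane `V_ℓ E`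
would make it abelian (`commute_of_forall_commute_of_not_exists_eq_smul_one`). The irreducibility
hypothesis of the fact is not used. [cite: Faltings1983Endlichkeit, §5 Satz 4 (⊗ ℚ_ℓ form; case of complex multiplication over K̄)]
[cite: Serre1968, Ch. IV §2.2 (Remark)] -/
theorem exists_eq_smul_one_of_equivariant_of_not_hasRationalCM_of_hasCM (hCM : W.HasCM) :
    exists_eq_smul_one_of_equivariant_of_not_hasRationalCM W ℓ := by
  intro _ _ hnCM _ G hG
  have hℓK : ((ℓ : ℕ) : K) ≠ 0 := Nat.cast_ne_zero.mpr (Fact.out : ℓ.Prime).ne_zero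
  by_contra hG'
  obtain ⟨σ, τ, hστ⟩ := exists_mul_ne_mul_of_hasCM W ℓ hCM hnCM
  exact hστ (commute_of_forall_commute_of_not_exists_eq_smul_one
    (finrank_rationalTateModule_eq_two_holds W ℓ hℓK) (rationalGaloisRepTate W ℓ)
    (fun σ ↦ LinearMap.ext fun v ↦ hG σ v) hG' σ τ)

/-- **What remains of the core fact is the case of no complex multiplication over `K̄`.** For a
Weierstrass curve `W` over `K` and a prime `ℓ`, the named fact
`exists_eq_smul_one_of_equivariant_of_not_hasRationalCM W ℓ` is equivalent to its restriction to
the case `¬ W.HasCM` (Serre's open-image case: a curve without complex multiplication; 1968,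
IV.2.2 Theorem). [cite: Faltings1983Endlichkeit, §5 Satz 4] [cite: Serre1968, Ch. IV §2.2] -/
theorem exists_eq_smul_one_of_equivariant_of_not_hasRationalCM_iff_of_not_hasCM :
    exists_eq_smul_one_of_equivariant_of_not_hasRationalCM W ℓ ↔
      (¬ W.HasCM → exists_eq_smul_one_of_equivariant_of_not_hasRationalCM W ℓ) := by
  refine ⟨fun h _ ↦ h, fun h ↦ ?_⟩
  by_cases hCM : W.HasCM
  · exact exists_eq_smul_one_of_equivariant_of_not_hasRationalCM_of_hasCM W ℓ hCM
  · exact h hCM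

/-- **Faltings' Satz 4 for an elliptic curve with complex multiplication over `K̄`**: for `W` over
`K` with `W.HasCM` and a prime `ℓ`, `mem_span_range_tateEndRingHom_iff W ℓ` — for `K` a number
field and `E = W` elliptic, a `ℤ_ℓ`-linear endomorphism of `T_ℓ E` is `Γ_K`-equivariant iff it
lies in `ℤ_ℓ · End_K(E)` (`End_K(E) ⊗ ℤ_ℓ ≅ End_{Γ_K}(T_ℓ E)`), unconditionally: the tree's
reduction `mem_span_range_tateEndRingHom_iff_of_core` (Shafarevich, line realization) applied to
the core fact for such curves. [cite: Faltings1983Endlichkeit, §5 Satz 4 (transl. PDF pp. 89–90; case of complex multiplication over K̄)] -/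
theorem mem_span_range_tateEndRingHom_iff_of_hasCM (hCM : W.HasCM) :
    mem_span_range_tateEndRingHom_iff W ℓ :=
  mem_span_range_tateEndRingHom_iff_of_core W ℓ
    (exists_eq_smul_one_of_equivariant_of_not_hasRationalCM_of_hasCM W ℓ hCM)

/-- **Faltings' subspace statement for `E × E`, `E` with complex multiplication over `K̄`**: the
named fact `stable_subspace_prod_eq_range W ℓ` of `FaltingsECSubspaces` (every `Γ_K`-stable
`ℚ_ℓ`-subspace of `V_ℓ(E × E) = V_ℓ E ⊕ V_ℓ E` is the image of an element of
`End_K(E × E) ⊗ ℚ_ℓ = M₂(End_K(E) ⊗ ℚ_ℓ)`) holds for every `W` with `W.HasCM`, unconditionally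
(`stable_subspace_prod_eq_range_of_core`). [cite: Faltings1983Endlichkeit, §5, Sätze 3–4 (proof, transl. PDF pp. 89–90; case of complex multiplication over K̄)] -/
theorem stable_subspace_prod_eq_range_of_hasCM (hCM : W.HasCM) :
    stable_subspace_prod_eq_range W ℓ :=
  stable_subspace_prod_eq_range_of_core W ℓ
    (exists_eq_smul_one_of_equivariant_of_not_hasRationalCM_of_hasCM W ℓ hCM)

/-- **Faltings' Korollar 1 for the pair `(E, E)`, `E` with complex multiplication over `K̄`**:
the named fact `mem_span_range_tateModule_map_of_equivariant W W ℓ` (every `Γ_K`-equivariant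
`ℤ_ℓ`-linear `T_ℓ E → T_ℓ E` is a `ℤ_ℓ`-combination of the `T_ℓ φ`, `φ : E → E` an isogeny over
`K`) holds for every `W` with `W.HasCM`, unconditionally
(`mem_span_range_tateModule_map_of_equivariant_self_of_core`).
[cite: Faltings1983Endlichkeit, §5 Satz 4, Korollar 1 (case of complex multiplication over K̄)] -/
theorem mem_span_range_tateModule_map_of_equivariant_self_of_hasCM (hCM : W.HasCM) :
    mem_span_range_tateModule_map_of_equivariant W W ℓ := by
  -- tactic form, as in `mem_span_range_tateModule_map_of_equivariant_self_of_core`: a term-mode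
  -- proof trips the `overlappingInstances` linter on the two `[W.IsElliptic]` binders of the
  -- unfolded fact for the pair `(W, W)`
  intro _ _ _
  exact mem_span_range_tateModule_map_of_equivariant_self_of_isogenyClass_of_core W ℓ
    (finite_isogenyClass_holds W)
    (exists_eq_smul_one_of_equivariant_of_not_hasRationalCM_of_hasCM W ℓ hCM)

/-! ## The frontier of the core fact after this file -/

/-- **What remains of the core fact.** Over a number field `K`, for an elliptic curve `E = W` and
a prime `ℓ`, the named fact `exists_eq_smul_one_of_equivariant_of_not_hasRationalCM W ℓ` follows
from its restriction to the joint case: `E` has **no** complex multiplication over `K̄`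
(`¬ W.HasCM`; otherwise `…_of_hasCM`), `K` is **totally imaginary** (no `K →+* ℝ`; otherwise
`…_of_realEmbedding`, `FaltingsECEndCoreCasesProofs`) and `ord_v(j(E)) ≥ 0` at **every** finite
place `v ∤ ℓ` (`v.valuation K W.j ≤ 1`; otherwise `…_of_one_lt_valuation_j'`, loc. cit.) — the
case of Serre's open-image theorem for curves with integral `j` (1968, IV.2.2; 1972) resp. of
Faltings' Sätze 1–2 for the abelian surfaces `(E × E)/G_n`, neither of which is in the tree.
[cite: Faltings1983Endlichkeit, §5 Satz 4] [cite: Serre1968, Ch. IV §2.2] -/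
theorem exists_eq_smul_one_of_equivariant_of_not_hasRationalCM_of_residual [NumberField K]
    [W.IsElliptic]
    (h : ¬ W.HasCM → IsEmpty (K →+* ℝ) →
      (∀ v : IsDedekindDomain.HeightOneSpectrum (NumberField.RingOfIntegers K),
        (ℓ : NumberField.RingOfIntegers K) ∉ v.asIdeal → v.valuation K W.j ≤ 1) →
      exists_eq_smul_one_of_equivariant_of_not_hasRationalCM W ℓ) :
    exists_eq_smul_one_of_equivariant_of_not_hasRationalCM W ℓ := by
  by_cases hCM : W.HasCM
  · exact exists_eq_smul_one_of_equivariant_of_not_hasRationalCM_of_hasCM W ℓ hCM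
  by_cases hR : IsEmpty (K →+* ℝ)
  swap
  · obtain ⟨φ⟩ := not_isEmpty_iff.mp hR
    exact exists_eq_smul_one_of_equivariant_of_not_hasRationalCM_of_realEmbedding W ℓ φ
  by_cases hj : ∀ v : IsDedekindDomain.HeightOneSpectrum (NumberField.RingOfIntegers K),
      (ℓ : NumberField.RingOfIntegers K) ∉ v.asIdeal → v.valuation K W.j ≤ 1
  · exact h hCM hR hj
  · push Not at hj
    obtain ⟨v, hℓv, hjv⟩ := hj
    exact exists_eq_smul_one_of_equivariant_of_not_hasRationalCM_of_one_lt_valuation_j' W ℓ hℓv hjv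

end Literature.AlgebraicGeometry.Motives
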